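import Mathlib
import HarnessLib
import Literature.Geometry.DiscreteGeometry.BondGraph
import Literature.Geometry.DiscreteGeometry.KissingPatterns
import Literature.Algebra.EuclideanLattices.FccBccLattices
import Summits.AtomisticToContinuum.Crystallization.Theorems.PricedLinkCensusSoftLayerPropagationStubMetricDet
import Summits.AtomisticToContinuum.Crystallization.Theorems.PricedLinkCensusSoftLayerPropagationStubMetricSolve

/-!
# Small-cluster rigidity IV: the trigonal bipyramid (two near-regular tetrahedra on a common face)
# (crux `SoftLayerPropagation`, line `Sketch`, stub `stub_metric`, registered sub-goal `metric_bipyramid`)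

Route `PricedLinkCensus`, crux `SoftLayerPropagation` (stmt-AtomisticToContinuum-14233), line `Sketch`.

**The bipyramid lemma (dihedral rigidity).**  A face `a b c` and two apices `d, e` of `ℝ³`; the nine
squared edges (`ab, ac, bc`, `da, db, dc`, `ea, eb, ec`) in `[1, 1 + α]`, `0 ≤ α ≤ 1/10`, and the
apices separated: `‖d − e‖² ≥ 1` (two contact tetrahedra on a common face in the bond setting; the
separation is the hard-core / nearest-neighbour lower bound between the two far sites).  Then

* the apex pair is centred on the face centroid to `O(α)`:
  `‖3(d + e) − 2(a + b + c)‖² ≤ 240 α²`, i.e. `e = (2/3)(a + b + c) − d + O(5.2 α)` — the "apex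
  prediction": the second tetrahedron on a face is where the reflection of the first puts it; two
  candidate far apices therefore coincide to `10.4 α < 1` edge lengths and are the same site;
* the apex axis is orthogonal to the face to within `α`: `|⟪d − e, b − a⟫|, |⟪d − e, c − a⟫| ≤ α`;
* the squared apex distance lies in `[8/3 − 4α/3 − 27α², 8/3 + 4α]` (regular value `8/3`,
  i.e. twice the height `√(2/3)` of the regular tetrahedron): at `α = 0.0404` (`η = 1/100`) the two
  far sites of a bonded pair of tetrahedra are between `1.60` and `1.69` edge lengths apart, in
  particular NOT bonded to each other and not coincident.

Proof: with `N = d − e` and `M' = 3(d+e) − 2(a+b+c)`, polarisation gives `|⟪N, b−a⟫|, |⟪N, c−a⟫| ≤ α`,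
`|⟪M', N⟫| ≤ 3α`, `|⟪M', b−a⟫|, |⟪M', c−a⟫| ≤ 4α`; the triple `(b − a, 2c − a − b, N)` is nearly
orthogonal (`γ = 3α`) with lengths `≥ 1, 17/10, 1`, so `norm_sq_solve_le` bounds `‖M'‖`; finally
`27‖N‖² + 3‖M'‖² + 4 Σ‖2a − b − c‖² = 18 Σᵥ (‖d−v‖² + ‖e−v‖²)` (parallelogram law + variance
decomposition over the three face vertices).  All `[folklore]`.
-/

noncomputable section

namespace Summit.AtomisticToContinuum.Crystallization.Theorems

open Literature.Geometry.DiscreteGeometry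

/-- Polarisation bookkeeping for the bipyramid `(a b c; d e)`: the inner products of `N = d − e` and
`M' = 3(d+e) − 2(a+b+c)` with the face vectors `b − a`, `c − a`, `2c − a − b`, `⟪M', N⟫`, the
near-orthogonality of `(b − a, 2c − a − b)`, the length of `2c − a − b`, and the averaged parallelogram
identity, all in terms of the nine squared edges and `‖d − e‖²`. [folklore] -/
theorem bipyramid_identities (a b c d e : EuclideanSpace ℝ (Fin 3)) :
    inner ℝ (d - e) (b - a) = (‖d - a‖ ^ 2 - ‖e - a‖ ^ 2 - ‖d - b‖ ^ 2 + ‖e - b‖ ^ 2) / 2 ∧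
    inner ℝ (d - e) (c - a) = (‖d - a‖ ^ 2 - ‖e - a‖ ^ 2 - ‖d - c‖ ^ 2 + ‖e - c‖ ^ 2) / 2 ∧
    inner ℝ ((3 : ℝ) • (d + e) - (2 : ℝ) • (a + b + c)) (d - e) =
      (‖d - a‖ ^ 2 - ‖e - a‖ ^ 2) + (‖d - b‖ ^ 2 - ‖e - b‖ ^ 2) + (‖d - c‖ ^ 2 - ‖e - c‖ ^ 2) ∧
    inner ℝ ((3 : ℝ) • (d + e) - (2 : ℝ) • (a + b + c)) (b - a) =
      3 / 2 * (‖d - a‖ ^ 2 + ‖e - a‖ ^ 2 - ‖d - b‖ ^ 2 - ‖e - b‖ ^ 2) + ‖b - c‖ ^ 2 - ‖a - c‖ ^ 2 ∧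
    inner ℝ ((3 : ℝ) • (d + e) - (2 : ℝ) • (a + b + c)) (c - a) =
      3 / 2 * (‖d - a‖ ^ 2 + ‖e - a‖ ^ 2 - ‖d - c‖ ^ 2 - ‖e - c‖ ^ 2) + ‖b - c‖ ^ 2 - ‖a - b‖ ^ 2 ∧
    inner ℝ ((2 : ℝ) • c - a - b) (d - e) =
      (‖d - a‖ ^ 2 - ‖e - a‖ ^ 2 - ‖d - c‖ ^ 2 + ‖e - c‖ ^ 2) -
        (‖d - a‖ ^ 2 - ‖e - a‖ ^ 2 - ‖d - b‖ ^ 2 + ‖e - b‖ ^ 2) / 2 ∧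
    inner ℝ ((3 : ℝ) • (d + e) - (2 : ℝ) • (a + b + c)) ((2 : ℝ) • c - a - b) =
      2 * (3 / 2 * (‖d - a‖ ^ 2 + ‖e - a‖ ^ 2 - ‖d - c‖ ^ 2 - ‖e - c‖ ^ 2) + ‖b - c‖ ^ 2 - ‖a - b‖ ^ 2) -
        (3 / 2 * (‖d - a‖ ^ 2 + ‖e - a‖ ^ 2 - ‖d - b‖ ^ 2 - ‖e - b‖ ^ 2) + ‖b - c‖ ^ 2 - ‖a - c‖ ^ 2) ∧
    inner ℝ (b - a) ((2 : ℝ) • c - a - b) = ‖a - c‖ ^ 2 - ‖b - c‖ ^ 2 ∧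
    ‖(2 : ℝ) • c - a - b‖ ^ 2 = 2 * ‖a - c‖ ^ 2 + 2 * ‖b - c‖ ^ 2 - ‖a - b‖ ^ 2 ∧
    27 * ‖d - e‖ ^ 2 + 3 * ‖(3 : ℝ) • (d + e) - (2 : ℝ) • (a + b + c)‖ ^ 2 +
        4 * ((2 * ‖a - b‖ ^ 2 + 2 * ‖a - c‖ ^ 2 - ‖b - c‖ ^ 2) +
          (2 * ‖a - b‖ ^ 2 + 2 * ‖b - c‖ ^ 2 - ‖a - c‖ ^ 2) +
          (2 * ‖a - c‖ ^ 2 + 2 * ‖b - c‖ ^ 2 - ‖a - b‖ ^ 2)) =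
      18 * ((‖d - a‖ ^ 2 + ‖e - a‖ ^ 2) + (‖d - b‖ ^ 2 + ‖e - b‖ ^ 2) + (‖d - c‖ ^ 2 + ‖e - c‖ ^ 2)) := by
  simp only [Literature.Algebra.EuclideanLattices.inner_fin_three,
    Literature.Algebra.EuclideanLattices.norm_sq_fin_three, PiLp.add_apply, PiLp.sub_apply,
    PiLp.smul_apply, smul_eq_mul]
  refine ⟨by ring, by ring, by ring, by ring, by ring, by ring, by ring, by ring, by ring, by ring⟩

/-- Numerics of the solving pass for the bipyramid (`ν = (1, 17/10, 1)`, `γ = 3α`,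
`β = (4α, 12α, 3α)`): `D · den ≤ (23.9 α)²` gives `D ≤ 240 α²` for `α ≤ 1/10`. [folklore] -/
theorem bipyramid_pass {D α : ℝ} (hα : 0 ≤ α) (hα' : α ≤ 1 / 10) (hD : 0 ≤ D)
    (h : D * (1 ^ 2 * (17 / 10) ^ 2 * 1 ^ 2 - (1 ^ 2 + (17 / 10) ^ 2 + 1 ^ 2) * (3 * α) ^ 2 - 2 * (3 * α) ^ 3) ≤
      (4 * α * (17 / 10) * 1 + 12 * α * 1 * 1 + 3 * α * 1 * (17 / 10)) ^ 2) : D ≤ 240 * α ^ 2 := by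
  have hden : (239 : ℝ) / 100 ≤ 1 ^ 2 * (17 / 10) ^ 2 * 1 ^ 2 -
      (1 ^ 2 + (17 / 10) ^ 2 + 1 ^ 2) * (3 * α) ^ 2 - 2 * (3 * α) ^ 3 := by
    nlinarith [mul_nonneg hα hα, mul_nonneg (mul_nonneg hα hα) hα]
  nlinarith [mul_le_mul_of_nonneg_left hden hD]

set_option maxHeartbeats 800000 in
/-- **Registered sub-goal `metric_bipyramid`: dihedral rigidity of two near-regular tetrahedra on a
common face, with explicit constants.**  Face `a b c`, apices `d e`; nine squared edges in
`[1, 1 + α]`, `0 ≤ α ≤ 1/10`, `‖d − e‖² ≥ 1`.  Then `‖3(d+e) − 2(a+b+c)‖² ≤ 240 α²`,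
`|⟪d − e, b − a⟫| ≤ α`, `|⟪d − e, c − a⟫| ≤ α`, and `8/3 − 4α/3 − 27α² ≤ ‖d − e‖² ≤ 8/3 + 4α`.
[folklore] -/
theorem metric_bipyramid : ∀ α : ℝ, 0 ≤ α → α ≤ 1 / 10 →
    ∀ (a b c d e : EuclideanSpace ℝ (Fin 3)),
      1 ≤ ‖a - b‖ ^ 2 → ‖a - b‖ ^ 2 ≤ 1 + α → 1 ≤ ‖a - c‖ ^ 2 → ‖a - c‖ ^ 2 ≤ 1 + α →
      1 ≤ ‖b - c‖ ^ 2 → ‖b - c‖ ^ 2 ≤ 1 + α →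
      1 ≤ ‖d - a‖ ^ 2 → ‖d - a‖ ^ 2 ≤ 1 + α → 1 ≤ ‖d - b‖ ^ 2 → ‖d - b‖ ^ 2 ≤ 1 + α →
      1 ≤ ‖d - c‖ ^ 2 → ‖d - c‖ ^ 2 ≤ 1 + α →
      1 ≤ ‖e - a‖ ^ 2 → ‖e - a‖ ^ 2 ≤ 1 + α → 1 ≤ ‖e - b‖ ^ 2 → ‖e - b‖ ^ 2 ≤ 1 + α →
      1 ≤ ‖e - c‖ ^ 2 → ‖e - c‖ ^ 2 ≤ 1 + α →
      1 ≤ ‖d - e‖ ^ 2 →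
      ‖(3 : ℝ) • (d + e) - (2 : ℝ) • (a + b + c)‖ ^ 2 ≤ 240 * α ^ 2 ∧
      |inner ℝ (d - e) (b - a)| ≤ α ∧ |inner ℝ (d - e) (c - a)| ≤ α ∧
      8 / 3 - 4 / 3 * α - 27 * α ^ 2 ≤ ‖d - e‖ ^ 2 ∧ ‖d - e‖ ^ 2 ≤ 8 / 3 + 4 * α := by
  intro α hα hα' a b c d e hab hab' hac hac' hbc hbc' hda hda' hdb hdb' hdc hdc' hea hea' heb heb'
    hec hec' hde
  obtain ⟨i1, i2, i3, i4, i5, i9, i10, i6, i7, i8⟩ := bipyramid_identities a b c d e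
  have ec : inner ℝ (b - a) (d - e) = inner ℝ (d - e) (b - a) := real_inner_comm _ _
  -- names (made opaque)
  generalize hN : d - e = N at *
  generalize hM : (3 : ℝ) • (d + e) - (2 : ℝ) • (a + b + c) = M at *
  generalize hf₂ : (2 : ℝ) • c - a - b = f₂ at *
  generalize hf₁ : b - a = f₁ at *
  -- small inner products
  have oN₁ : |inner ℝ N f₁| ≤ α :=
    abs_le.2 ⟨by linarith only [i1, hda, hea', hdb', heb], by linarith only [i1, hda', hea, hdb, heb']⟩
  have oN₂' : |inner ℝ N (c - a)| ≤ α :=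
    abs_le.2 ⟨by linarith only [i2, hda, hea', hdc', hec], by linarith only [i2, hda', hea, hdc, hec']⟩
  have o₁₂ : |inner ℝ f₁ f₂| ≤ 3 * α :=
    abs_le.2 ⟨by linarith only [i6, hac, hbc', hα], by linarith only [i6, hac', hbc, hα]⟩
  have o₁N : |inner ℝ f₁ N| ≤ 3 * α := by
    rw [ec]; exact oN₁.trans (by linarith only [hα])
  have o₂N : |inner ℝ f₂ N| ≤ 3 * α :=
    abs_le.2 ⟨by linarith only [i9, hda, hda', hea, hea', hdb, hdb', heb, heb', hdc, hdc', hec, hec'],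
      by linarith only [i9, hda, hda', hea, hea', hdb, hdb', heb, heb', hdc, hdc', hec, hec']⟩
  have mN : |inner ℝ M N| ≤ 3 * α :=
    abs_le.2 ⟨by linarith only [i3, hda, hea', hdb, heb', hdc, hec'], by linarith only [i3, hda', hea, hdb', heb, hdc', hec]⟩
  have m₁ : |inner ℝ M f₁| ≤ 4 * α :=
    abs_le.2 ⟨by linarith only [i4, hda, hea, hdb', heb', hbc, hac'], by linarith only [i4, hda', hea', hdb, heb, hbc', hac]⟩
  have m₂ : |inner ℝ M f₂| ≤ 12 * α :=
    abs_le.2 ⟨by linarith only [i10, hda, hda', hea, hea', hdb, hdb', heb, heb', hdc, hdc', hec, hec', hbc, hbc',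
        hab, hab', hac, hac'],
      by linarith only [i10, hda, hda', hea, hea', hdb, hdb', heb, heb', hdc, hdc', hec, hec', hbc, hbc',
        hab, hab', hac, hac']⟩
  -- length floors: `‖f₁‖ ≥ 1`, `‖f₂‖ ≥ 17/10` (`‖f₂‖² ≥ 3 − α ≥ 2.89`), `‖N‖ ≥ 1`
  have hab₂ : 1 ≤ ‖f₁‖ ^ 2 := by rw [← hf₁, norm_sub_rev]; exact hab
  have l₁ : 1 ≤ ‖f₁‖ := (pow_le_pow_iff_left₀ zero_le_one (norm_nonneg _) two_ne_zero).1 (by simpa using hab₂)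
  have q₂ : (17 / 10 : ℝ) ^ 2 ≤ ‖f₂‖ ^ 2 := by linarith only [i7, hac, hbc, hab', hα']
  have l₂ : (17 : ℝ) / 10 ≤ ‖f₂‖ := (pow_le_pow_iff_left₀ (by norm_num) (norm_nonneg _) two_ne_zero).1 q₂
  have l₃ : 1 ≤ ‖N‖ := (pow_le_pow_iff_left₀ zero_le_one (norm_nonneg _) two_ne_zero).1 (by simpa using hde)
  -- solve for `M`
  have hγ : 0 ≤ 3 * α := by linarith only [hα]
  have sol := norm_sq_solve_le one_pos (by norm_num : (0 : ℝ) < 17 / 10) one_pos hγ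
    (by linarith only [hα] : 0 ≤ 4 * α) (by linarith only [hα] : 0 ≤ 12 * α)
    (by linarith only [hα] : 0 ≤ 3 * α) M f₁ f₂ N l₁ l₂ l₃ o₁₂ o₁N o₂N m₁ m₂ mN
  have hM0 : 0 ≤ ‖M‖ ^ 2 := sq_nonneg _
  have hM2 : ‖M‖ ^ 2 ≤ 240 * α ^ 2 := bipyramid_pass hα hα' hM0 sol
  -- the apex distance from the averaged parallelogram identity `i8`
  refine ⟨hM2, oN₁, oN₂', ?_, ?_⟩
  · linarith only [i8, hM2, hab', hac', hbc', hda, hea, hdb, heb, hdc, hec, sq_nonneg α]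
  · linarith only [i8, hM0, hab, hac, hbc, hda', hea', hdb', heb', hdc', hec']

/-- **Corollary: uniqueness of the far apex.**  If `e` and `e'` both complete the tetrahedron
`(a, b, c, d)` to a bipyramid as in `metric_bipyramid` (nine squared edges in `[1, 1+α]`, each at
squared distance `≥ 1` from `d`), then `‖e − e'‖² ≤ 107 α²` (`< 1` for `α ≤ 1/10`, whereas two
distinct sites of the bond setting are `≥ 1/1.01` apart): the far apex is unique. [folklore] -/
theorem metric_bipyramid_unique {α : ℝ} (hα : 0 ≤ α) (hα' : α ≤ 1 / 10)
    (a b c d e e' : EuclideanSpace ℝ (Fin 3))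
    (hab : 1 ≤ ‖a - b‖ ^ 2) (hab' : ‖a - b‖ ^ 2 ≤ 1 + α) (hac : 1 ≤ ‖a - c‖ ^ 2) (hac' : ‖a - c‖ ^ 2 ≤ 1 + α)
    (hbc : 1 ≤ ‖b - c‖ ^ 2) (hbc' : ‖b - c‖ ^ 2 ≤ 1 + α)
    (hda : 1 ≤ ‖d - a‖ ^ 2) (hda' : ‖d - a‖ ^ 2 ≤ 1 + α) (hdb : 1 ≤ ‖d - b‖ ^ 2) (hdb' : ‖d - b‖ ^ 2 ≤ 1 + α)
    (hdc : 1 ≤ ‖d - c‖ ^ 2) (hdc' : ‖d - c‖ ^ 2 ≤ 1 + α)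
    (hea : 1 ≤ ‖e - a‖ ^ 2) (hea' : ‖e - a‖ ^ 2 ≤ 1 + α) (heb : 1 ≤ ‖e - b‖ ^ 2) (heb' : ‖e - b‖ ^ 2 ≤ 1 + α)
    (hec : 1 ≤ ‖e - c‖ ^ 2) (hec' : ‖e - c‖ ^ 2 ≤ 1 + α)
    (hea₂ : 1 ≤ ‖e' - a‖ ^ 2) (hea₂' : ‖e' - a‖ ^ 2 ≤ 1 + α) (heb₂ : 1 ≤ ‖e' - b‖ ^ 2)
    (heb₂' : ‖e' - b‖ ^ 2 ≤ 1 + α) (hec₂ : 1 ≤ ‖e' - c‖ ^ 2) (hec₂' : ‖e' - c‖ ^ 2 ≤ 1 + α)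
    (hde : 1 ≤ ‖d - e‖ ^ 2) (hde' : 1 ≤ ‖d - e'‖ ^ 2) :
    ‖e - e'‖ ^ 2 ≤ 107 * α ^ 2 := by
  have h1 := (metric_bipyramid α hα hα' a b c d e hab hab' hac hac' hbc hbc' hda hda' hdb hdb' hdc hdc'
    hea hea' heb heb' hec hec' hde).1
  have h2 := (metric_bipyramid α hα hα' a b c d e' hab hab' hac hac' hbc hbc' hda hda' hdb hdb' hdc hdc'
    hea₂ hea₂' heb₂ heb₂' hec₂ hec₂' hde').1
  -- `3 (e − e') = M − M'`
  have hdiff : (3 : ℝ) • (e - e') =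
      ((3 : ℝ) • (d + e) - (2 : ℝ) • (a + b + c)) - ((3 : ℝ) • (d + e') - (2 : ℝ) • (a + b + c)) := by
    simp only [smul_sub, smul_add]; abel
  have hn : 3 * ‖e - e'‖ ≤ ‖(3 : ℝ) • (d + e) - (2 : ℝ) • (a + b + c)‖ +
      ‖(3 : ℝ) • (d + e') - (2 : ℝ) • (a + b + c)‖ := by
    have := norm_sub_le ((3 : ℝ) • (d + e) - (2 : ℝ) • (a + b + c))
      ((3 : ℝ) • (d + e') - (2 : ℝ) • (a + b + c))
    rw [← hdiff, norm_smul, Real.norm_eq_abs, abs_of_pos (by norm_num : (0 : ℝ) < 3)] at this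
    exact this
  have s1 : ‖(3 : ℝ) • (d + e) - (2 : ℝ) • (a + b + c)‖ ≤ Real.sqrt 240 * α := by
    have := Real.sqrt_le_sqrt h1
    rwa [Real.sqrt_sq (norm_nonneg _), Real.sqrt_mul (by norm_num), Real.sqrt_sq hα] at this
  have s2 : ‖(3 : ℝ) • (d + e') - (2 : ℝ) • (a + b + c)‖ ≤ Real.sqrt 240 * α := by
    have := Real.sqrt_le_sqrt h2
    rwa [Real.sqrt_sq (norm_nonneg _), Real.sqrt_mul (by norm_num), Real.sqrt_sq hα] at this
  have hs : Real.sqrt 240 ≤ 31 / 2 := by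
    rw [Real.sqrt_le_left (by norm_num)]; norm_num
  have h3 : 3 * ‖e - e'‖ ≤ 31 * α := by nlinarith
  have h4 : ‖e - e'‖ ≤ 31 / 3 * α := by linarith
  have : ‖e - e'‖ ^ 2 ≤ (31 / 3 * α) ^ 2 := pow_le_pow_left₀ (norm_nonneg _) h4 2
  nlinarith [this]

end Summit.AtomisticToContinuum.Crystallization.Theorems

end
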